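import Literature.GroupTheory.ArithmeticGroups.PeriodicUnipotentModN
import Mathlib.RingTheory.IntegralClosure.IsIntegralClosure.Basic
import Mathlib.RingTheory.Localization.FractionRing
import Mathlib.FieldTheory.IsAlgClosed.AlgebraicClosure
import Mathlib.LinearAlgebra.Matrix.Adjugate
import Mathlib.RingTheory.Ideal.Quotient.Basic
import HarnessLib

/-!
# Periodic matrices unipotent modulo `n` over an integral domain: Silverberg–Zarhin 1996, Lemma 6.6, Theorems 6.7, 6.2 (b), 6.3 (`k = 2`), 6.4

Family `hodge`, layer `Literature/GroupTheory/ArithmeticGroups`; sequel of `PeriodicUnipotentModN`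
(`SilverbergZarhin.exceptionalSet` `N(k)`, `SilverbergZarhin.orderBound` `R(k, n)`, Corollary 3.3
`SilverbergZarhin.pow_orderBound_eq_one`, Theorem 6.2 over `ℤ`
`SilverbergZarhin.matrix_pow_orderBound_eq_one`), which it extends from `𝒪 = ℤ` to an arbitrary
integral domain `𝒪` of characteristic zero, following §6 of the paper word for word. Theorems
only; no definition, no named fact (D-0026).

A. Silverberg, Yu. G. Zarhin, *Variations on a theme of Minkowski and Serre*, J. Pure Appl. Algebra
111 (1996) 285–302 [SilverbergZarhin1996], pp. 293–294 (held text
`paper:doi-10-1016-0022-4049-95-00113-1` p0009–p0010):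

**Lemma 6.6.** "Suppose `𝒪` and `𝒪̃` are integral domains of characteristic zero, `𝒪` is a subring
of `𝒪̃`, and every element of `𝒪̃` is integral over `𝒪`. If `v ∈ 𝒪` and `v` is not a unit in `𝒪`,
then `v` is not a unit in `𝒪̃`." (Proof: "Suppose `v⁻¹ ∈ 𝒪̃`. Then `v⁻¹` is integral over `𝒪` …
`v⁻¹ = -a_{m-1} - a_{m-2}v - ⋯ - a₀v^{m-1}`. Therefore `v⁻¹ ∈ 𝒪`.") This is Mathlib's
`RingHom.IsIntegral.isLocalHom` / `Algebra.IsIntegral.isLocalHom` (an injective integral ring map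
is a local homomorphism); restated here in the printed form (`SilverbergZarhin.not_isUnit_of_isIntegral`).

**Theorem 6.7.** "Suppose `𝒪` is an integral domain of characteristic zero, `n` and `k` are positive
integers such that no rational prime which divides `n` is a unit in `𝒪`, `A ∈ M_g(𝒪)` satisfies
`(A - I)^k ∈ nM_g(𝒪)`, and `λ` is an eigenvalue of `A` which is a root of unity. Then
`λ^{R(k,n)} = 1`." (Proof, as printed: "View the eigenvalues of `A` as lying in the integral closure
`𝒪̃` of `𝒪` in an algebraically closed field containing `𝒪`. By Lemma 6.6, no rational prime which
divides `n` is a unit in `𝒪̃`. Write `(A - I)^k = nB` with `B ∈ M_g(𝒪)`. Then we have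
`(λ - 1)^k = nμ` where `μ` is an eigenvalue of `B`, so `μ ∈ 𝒪̃`. Applying Corollary 3.3 to the ring
`𝒪̃` and the element `λ` shows that `λ` is an `R(k,n)`th root of unity.")
(`SilverbergZarhin.pow_orderBound_eq_one_of_isRoot_charpoly`; any field `L ⊇ 𝒪` containing `λ`
will do, the integral closure being taken in `L`.)

**Theorem 6.2** in case (b) for integral domains ("`𝒪` is commutative and for every rational prime
divisor `ℓ` of `n`, `1 + ℓ𝒪` has no `𝒪`-zero-divisors" — for a domain this says exactly that no
prime `ℓ ∣ n` is a unit): "If `A ∈ M_g(𝒪)` is a matrix of finite multiplicative order such that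
`(A - I)^k ∈ nM_g(𝒪)`, then `A^{R(k,n)} = I`." Here deduced from Theorem 6.7 (all eigenvalues of
`A^{R(k,n)}` are `1`, so it is a neat matrix of finite order, hence `= 1`,
`NeatSubgroups.IsNeat.eq_one_of_pow_eq_one`) rather than from the paper's Theorem 4.4
(`SilverbergZarhin.matrix_pow_orderBound_eq_one_of_isDomain`; the case `𝒪 = ℤ` is
`PeriodicUnipotentModN`'s `matrix_pow_orderBound_eq_one`).
-- TODO(general form): Theorem 6.2 (a) (non-commutative `𝒪` without infinitely `ℓ`-divisible
-- elements) and (b) for commutative rings with zero-divisors go through the paper's Theorem 4.4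
-- (projective modules over `ℤ[α]`), not formalised here.

**Theorem 6.3** (p. 292, the case `k = 2`) and **Theorem 6.4** (p. 292), for integral domains:
"Suppose `n ≥ 4` … If `A ∈ M_g(𝒪)` is a matrix of finite multiplicative order, `0 ≤ a ≤ g`, and `b`
is an `a × (g - a)` matrix over `𝒪` such that `A ∈ (I_a b; 0 I_{g-a}) + nM_g(𝒪)`, then `A = I`."
(`SilverbergZarhin.matrix_eq_one_of_isDomain_of_blockUnipotent`; `n = 4` is Theorem 6.3 with
`k = 2`, `SilverbergZarhin.matrix_eq_one_of_isDomain_of_blockUnipotent_four`, proved as printed: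
`A² = I`, `A = I + 2B` with `B ≡ (0 *; 0 0) (mod 2)`, `(I + B)(I - A) = 0`, `det(I + B) ∈ 1 + 2𝒪`.)
Sharpness of `n ≥ 4` (`n = 3`, `n = 2`; our examples, cf. Example 6.5): `sharp_blockUnipotent_three`,
`sharp_blockUnipotent_two`.

## References

* [SilverbergZarhin1996] A. Silverberg, Yu. G. Zarhin, J. Pure Appl. Algebra 111 (1996):
  Lemma 6.6, Theorem 6.7 (pp. 293–294), Theorem 6.2 (p. 291), Theorems 6.3, 6.4 (p. 292),
  Example 6.5, Corollary 3.3.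
-/

namespace Literature.GroupTheory.ArithmeticGroups

namespace SilverbergZarhin

open Polynomial

/-! ### §1 Lemma 6.6: non-units stay non-units in integral extensions -/

/-- **Lemma 6.6** ([SilverbergZarhin1996]): if `𝒪 → 𝒪̃` is an injective integral extension of
commutative rings and `v ∈ 𝒪` is not a unit in `𝒪`, then `v` is not a unit in `𝒪̃`. (Mathlib:
an injective integral ring homomorphism is a local homomorphism.)
[cite: SilverbergZarhin1996, Lemma 6.6] -/
theorem not_isUnit_of_isIntegral {O O' : Type*} [CommRing O] [CommRing O'] [Algebra O O']
    [Algebra.IsIntegral O O'] (hinj : Function.Injective (algebraMap O O')) {v : O}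
    (hv : ¬ IsUnit v) : ¬ IsUnit (algebraMap O O' v) := by
  haveI := (faithfulSMul_iff_algebraMap_injective O O').2 hinj
  rwa [isUnit_map_iff (algebraMap O O')]

/-- Lemma 6.6 for the integral closure `𝒪̃ = 𝒪̄ ∩ L` of `𝒪` in a field `L ⊇ 𝒪` and a rational
prime `p`: if `p` is not a unit in `𝒪`, it is not a unit in `𝒪̃`.
[cite: SilverbergZarhin1996, Lemma 6.6 and proof of Thm. 6.7] -/
theorem not_isUnit_natCast_integralClosure {O : Type*} [CommRing O] {L : Type*} [Field L]
    [Algebra O L] (hinj : Function.Injective (algebraMap O L)) {p : ℕ} (hp : ¬ IsUnit (p : O)) :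
    ¬ IsUnit (p : integralClosure O L) := by
  have hinj' : Function.Injective (algebraMap O (integralClosure O L)) := fun a b h =>
    hinj (by simpa using congrArg (fun z : integralClosure O L => (z : L)) h)
  rw [← map_natCast (algebraMap O (integralClosure O L)) p]
  exact not_isUnit_of_isIntegral hinj' hp

/-! ### §2 Theorem 6.7: the root-of-unity eigenvalues of `A` with `(A - 1)^k ∈ n M_g(𝒪)` -/

section Eigenvalues

variable {O : Type*} [CommRing O] {L : Type*} [Field L] [Algebra O L]
variable {ι : Type*} [Fintype ι] [DecidableEq ι]

/-- If `x` is an eigenvalue of `G ∈ M_g(L)` and `(G - 1)^k = n·B` with `B` the image of a matrix over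
`𝒪`, then `(x - 1)^k = nμ` for some `μ ∈ L` integral over `𝒪` (an eigenvalue of `B` if `n ≠ 0`;
`μ = 0` if `n = 0`): "`(λ - 1)^k = nμ` where `μ` is an eigenvalue of `B`, so `μ ∈ 𝒪̃`".
[cite: SilverbergZarhin1996, proof of Thm. 6.7] -/
theorem exists_isIntegral_pow_sub_one_eq_mul [CharZero L] {G : Matrix ι ι L} {B : Matrix ι ι O}
    {k n : ℕ} (hGB : (G - 1) ^ k = (n : L) • B.map (algebraMap O L)) {x : L}
    (hx : G.charpoly.IsRoot x) : ∃ μ : L, IsIntegral O μ ∧ (x - 1) ^ k = n * μ := by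
  rw [Polynomial.IsRoot.def, Matrix.eval_charpoly] at hx
  have hcomm : Commute (Matrix.scalar ι (x - 1)) (G - 1) :=
    Matrix.scalar_commute (x - 1) (fun r' => Commute.all _ r') _
  have h := congr_arg Matrix.det (hcomm.geom_sum₂_mul k)
  have hx' : (Matrix.scalar ι (x - 1) - (G - 1)).det = 0 := by
    rw [map_sub, map_one, sub_sub_sub_cancel_right]
    exact hx
  rw [Matrix.det_mul, hx', mul_zero, ← map_pow, hGB] at h
  rcases Nat.eq_zero_or_pos n with rfl | hn
  · refine ⟨0, isIntegral_zero, ?_⟩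
    rw [Nat.cast_zero, zero_smul, sub_zero, Matrix.scalar_apply, Matrix.det_diagonal,
      Finset.prod_const, Finset.card_univ] at h
    rw [Nat.cast_zero, zero_mul]
    rcases Nat.eq_zero_or_pos (Fintype.card ι) with hc | hc
    · rw [hc, pow_zero] at h
      exact absurd h zero_ne_one
    · exact (pow_eq_zero_iff hc.ne').1 h.symm
  · have hnL : (n : L) ≠ 0 := Nat.cast_ne_zero.2 hn.ne'
    set μ := (x - 1) ^ k / n with hμ
    have hnμ : (n : L) * μ = (x - 1) ^ k := by rw [hμ]; exact mul_div_cancel₀ _ hnL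
    refine ⟨μ, ?_, hnμ.symm⟩
    -- `μ` is a root of the characteristic polynomial of `B`, which is monic over `𝒪`
    have e : Matrix.scalar ι ((x - 1) ^ k) - (n : L) • B.map (algebraMap O L) =
        (n : L) • (Matrix.scalar ι μ - B.map (algebraMap O L)) := by
      ext i j
      simp only [Matrix.sub_apply, Matrix.scalar_apply, Matrix.diagonal_apply, Matrix.smul_apply,
        smul_eq_mul, mul_sub]
      split_ifs
      · rw [hnμ]
      · simp
    rw [e, Matrix.det_smul] at h
    have hdet : (Matrix.scalar ι μ - B.map (algebraMap O L)).det = 0 :=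
      (mul_eq_zero.1 h.symm).resolve_left (pow_ne_zero _ hnL)
    refine ⟨B.charpoly, B.charpoly_monic, ?_⟩
    rw [← Polynomial.eval_map, ← Matrix.charpoly_map, Matrix.eval_charpoly]
    exact hdet

/-- The eigenvalues of a matrix of finite order (`G ^ N = 1`) are `N`-th roots of unity. [folklore] -/
private theorem pow_eq_one_of_isRoot_charpoly {G : Matrix ι ι L} {N : ℕ} (hG : G ^ N = 1) {x : L}
    (hx : G.charpoly.IsRoot x) : x ^ N = 1 := by
  rw [Polynomial.IsRoot.def, Matrix.eval_charpoly] at hx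
  have hcomm : Commute (Matrix.scalar ι x) G := Matrix.scalar_commute x (fun r' => Commute.all x r') G
  have h := congr_arg Matrix.det (hcomm.geom_sum₂_mul N)
  rw [Matrix.det_mul, hx, mul_zero, hG, ← map_pow, ← map_one (Matrix.scalar ι), ← map_sub,
    Matrix.scalar_apply, Matrix.det_diagonal, Finset.prod_const, Finset.card_univ] at h
  rcases Nat.eq_zero_or_pos (Fintype.card ι) with hc | hc
  · rw [hc, pow_zero] at h
    exact absurd h zero_ne_one
  · exact sub_eq_zero.1 ((pow_eq_zero_iff hc.ne').1 h.symm)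

variable [CharZero L]

/-- **Theorem 6.7** ([SilverbergZarhin1996, pp. 293–294]): "Suppose `𝒪` is an integral domain of
characteristic zero, `n` and `k` are positive integers such that no rational prime which divides
`n` is a unit in `𝒪`, `A ∈ M_g(𝒪)` satisfies `(A - I)^k ∈ nM_g(𝒪)`, and `λ` is an eigenvalue of
`A` which is a root of unity. Then `λ^{R(k,n)} = 1`." Here `λ ∈ L` for any field `L ⊇ 𝒪`
of characteristic zero (so `𝒪` is a domain of characteristic zero; an eigenvalue is a root of
the characteristic polynomial of `A` in `L`), `(A - 1)^k = n·B`.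
Proof as printed: in `𝒪̃ = 𝒪̄ ∩ L` no prime dividing `n` is a unit (Lemma 6.6),
`(λ - 1)^k = nμ` with `μ ∈ 𝒪̃` an eigenvalue of `B`, and Corollary 3.3 applies to `λ ∈ 𝒪̃`.
[cite: SilverbergZarhin1996, Thm. 6.7] -/
theorem pow_orderBound_eq_one_of_isRoot_charpoly (hinj : Function.Injective (algebraMap O L))
    {n k : ℕ} (hn : ∀ p : ℕ, p.Prime → p ∣ n → ¬ IsUnit (p : O)) {A B : Matrix ι ι O}
    (hcong : (A - 1) ^ k = (n : O) • B) {x : L}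
    (hx : (A.map (algebraMap O L)).charpoly.IsRoot x) (hxfin : IsOfFinOrder x) :
    x ^ orderBound k n = 1 := by
  obtain ⟨N, hN, hxN⟩ := isOfFinOrder_iff_pow_eq_one.1 hxfin
  have hGB : (A.map (algebraMap O L) - 1) ^ k = (n : L) • B.map (algebraMap O L) := by
    have h := congr_arg (algebraMap O L).mapMatrix hcong
    rw [Nat.cast_smul_eq_nsmul, map_pow, map_sub, map_one, map_nsmul, RingHom.mapMatrix_apply,
      RingHom.mapMatrix_apply] at h
    rw [h, Nat.cast_smul_eq_nsmul]
  obtain ⟨μ, hμint, hμ⟩ := exists_isIntegral_pow_sub_one_eq_mul hGB hx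
  -- Corollary 3.3 in `𝒪̃ = 𝒪̄ ∩ L`
  have hxint : IsIntegral O x := ⟨X ^ N - 1, monic_X_pow_sub_C 1 hN.ne', by simp [hxN]⟩
  set a : integralClosure O L := ⟨x, (mem_integralClosure_iff O L).2 hxint⟩ with hadef
  have ha : IsOfFinOrder a :=
    isOfFinOrder_iff_pow_eq_one.2 ⟨N, hN, Subtype.ext (by simp [hadef, hxN])⟩
  have hcong' : ∃ β : integralClosure O L, (a - 1) ^ k = n * β :=
    ⟨⟨μ, (mem_integralClosure_iff O L).2 hμint⟩, Subtype.ext (by simp [hadef, hμ])⟩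
  have h := pow_orderBound_eq_one (O := integralClosure O L) (k := k)
    (fun p hp hpn => not_isUnit_natCast_integralClosure hinj (hn p hp hpn)) ha hcong'
  simpa [hadef] using congr_arg Subtype.val h

/-- **Theorem 6.7, "in particular"**: if moreover `n ∉ N(k)`, every root-of-unity eigenvalue of `A`
is `1`. [cite: SilverbergZarhin1996, Thm. 6.7 and Cor. 3.3] -/
theorem eq_one_of_isRoot_charpoly_of_not_mem_exceptionalSet
    (hinj : Function.Injective (algebraMap O L)) {n k : ℕ} (hnN : n ∉ exceptionalSet k)
    (hn : ∀ p : ℕ, p.Prime → p ∣ n → ¬ IsUnit (p : O)) {A B : Matrix ι ι O}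
    (hcong : (A - 1) ^ k = (n : O) • B) {x : L}
    (hx : (A.map (algebraMap O L)).charpoly.IsRoot x) (hxfin : IsOfFinOrder x) : x = 1 := by
  have h := pow_orderBound_eq_one_of_isRoot_charpoly hinj hn hcong hx hxfin
  rwa [orderBound_of_not_mem hnN, pow_one] at h

end Eigenvalues

/-! ### §3 Theorem 6.2 (b) for integral domains -/

section Matrices

variable {O : Type*} [CommRing O]
variable {ι : Type*} [Fintype ι] [DecidableEq ι]

/-- Over an algebraically closed field an eigenvalue of `G ^ R` (`R ≥ 1`) is `x ^ R` for an
eigenvalue `x` of `G`. [folklore] -/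
private theorem exists_isRoot_charpoly_of_pow {L : Type*} [Field L] [IsAlgClosed L]
    {G : Matrix ι ι L} {R : ℕ} (hR : 0 < R) {y : L} (hy : (G ^ R).charpoly.IsRoot y) :
    ∃ x : L, G.charpoly.IsRoot x ∧ x ^ R = y := by
  classical
  set p : L[X] := X ^ R - C y with hp
  have hmonic : p.Monic := monic_X_pow_sub_C y hR.ne'
  have hprod := (IsAlgClosed.splits p).eq_prod_roots_of_monic hmonic
  have hGp : aeval G p = G ^ R - Matrix.scalar ι y := by
    rw [hp, map_sub, map_pow, aeval_X, aeval_C]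
    rfl
  have hdet : (aeval G p).det = 0 := by
    rw [Polynomial.IsRoot.def, Matrix.eval_charpoly] at hy
    rw [hGp, ← neg_sub, Matrix.det_neg, hy, mul_zero]
  rw [hprod, ← Multiset.coe_toList p.roots, Multiset.map_coe, Multiset.prod_coe, map_list_prod,
    List.map_map, ← Matrix.coe_detMonoidHom, map_list_prod, List.map_map, List.prod_eq_zero_iff,
    List.mem_map] at hdet
  obtain ⟨x, hx, hx0⟩ := hdet
  rw [Multiset.mem_toList] at hx
  refine ⟨x, ?_, ?_⟩
  · simp only [Function.comp_apply, Matrix.coe_detMonoidHom, map_sub, aeval_X, aeval_C] at hx0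
    rw [Polynomial.IsRoot.def, Matrix.eval_charpoly, ← neg_sub, Matrix.det_neg]
    have : (G - Matrix.scalar ι x).det = 0 := hx0
    rw [this, mul_zero]
  · have := (Polynomial.mem_roots hmonic.ne_zero).1 hx
    rw [Polynomial.IsRoot.def, hp, eval_sub, eval_pow, eval_X, eval_C, sub_eq_zero] at this
    exact this

/-- Theorem 6.2 (b) for domains, with the auxiliary algebraically closed field `L ⊇ 𝒪` explicit.
[cite: SilverbergZarhin1996, Thm. 6.2 and Thm. 6.7] -/
theorem matrix_pow_orderBound_eq_one_of_isDomain_aux (L : Type*) [Field L] [Algebra O L]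
    [IsAlgClosed L] [CharZero L] (hinj : Function.Injective (algebraMap O L))
    {n k : ℕ} (hn : ∀ p : ℕ, p.Prime → p ∣ n → ¬ IsUnit (p : O)) {A B : Matrix ι ι O}
    (hA : IsOfFinOrder A) (hcong : (A - 1) ^ k = (n : O) • B) : A ^ orderBound k n = 1 := by
  classical
  rcases Nat.eq_zero_or_pos (orderBound k n) with h0 | hRpos
  · rw [h0, pow_zero]
  set R := orderBound k n with hRdef
  obtain ⟨N, hN, hAN⟩ := isOfFinOrder_iff_pow_eq_one.1 hA
  set G : Matrix ι ι L := A.map (algebraMap O L) with hGdef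
  have hGN : G ^ N = 1 := by
    rw [hGdef, ← RingHom.mapMatrix_apply, ← map_pow, hAN, map_one]
  -- every eigenvalue `x` of `A` is a root of unity (Theorem 6.7 applies): `x ^ R = 1`
  have hroots : ∀ x : L, G.charpoly.IsRoot x → x ^ R = 1 := fun x hx =>
    pow_orderBound_eq_one_of_isRoot_charpoly hinj hn hcong hx
      (isOfFinOrder_iff_pow_eq_one.2 ⟨N, hN, pow_eq_one_of_isRoot_charpoly hGN hx⟩)
  -- hence every eigenvalue of `A ^ R` is `1`: its eigenvalue group is trivial, `A ^ R` is neat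
  have hneat : IsNeat L (A ^ R) := by
    have hbot : eigenvalueSubgroup L (A ^ R) = ⊥ := by
      rw [eigenvalueSubgroup, Subgroup.closure_eq_bot_iff]
      intro u hu
      rw [Set.mem_setOf_eq, ← Matrix.charpoly_map,
        Polynomial.mem_roots (Matrix.charpoly_monic _).ne_zero] at hu
      have hmap : (A ^ R).map (algebraMap O L) = G ^ R := by
        rw [hGdef, ← RingHom.mapMatrix_apply, ← RingHom.mapMatrix_apply, map_pow]
      rw [hmap] at hu
      obtain ⟨x, hx, hxu⟩ := exists_isRoot_charpoly_of_pow hRpos hu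
      rw [Set.mem_singleton_iff, ← Units.val_eq_one, ← hxu]
      exact hroots x hx
    intro u hu _
    rw [hbot] at hu
    exact (Subgroup.mem_bot).1 hu
  have hfin : (A ^ R) ^ N = 1 := by rw [← pow_mul, mul_comm, pow_mul, hAN, one_pow]
  exact hneat.eq_one_of_pow_eq_one hinj hN hfin

variable [IsDomain O] [CharZero O]

/-- **Theorem 6.2 (b) for integral domains** ([SilverbergZarhin1996, Thm. 6.2]): `𝒪` an integral
domain of characteristic zero in which no rational prime dividing `n` is a unit; "if `A ∈ M_g(𝒪)`
is a matrix of finite multiplicative order such that `(A - I)^k ∈ nM_g(𝒪)`, then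
`A^{R(k,n)} = I`." (Via Theorem 6.7 in an algebraic closure of `Frac 𝒪`: all eigenvalues of
`A^{R(k,n)}` are `1`, and a neat matrix of finite order is the identity.)
[cite: SilverbergZarhin1996, Thm. 6.2] -/
theorem matrix_pow_orderBound_eq_one_of_isDomain {n k : ℕ}
    (hn : ∀ p : ℕ, p.Prime → p ∣ n → ¬ IsUnit (p : O)) {A B : Matrix ι ι O}
    (hA : IsOfFinOrder A) (hcong : (A - 1) ^ k = (n : O) • B) : A ^ orderBound k n = 1 := by
  let K := FractionRing O
  let L := AlgebraicClosure K
  have hinj : Function.Injective (algebraMap O L) := by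
    rw [IsScalarTower.algebraMap_eq O K L, RingHom.coe_comp]
    exact (algebraMap K L).injective.comp (IsFractionRing.injective O K)
  haveI : CharZero L := charZero_of_injective_algebraMap hinj
  exact matrix_pow_orderBound_eq_one_of_isDomain_aux L hinj hn hA hcong

/-- **Theorem 6.2 (b) for integral domains, "in particular"**: if moreover `n ∉ N(k)` then `A = 1`.
[cite: SilverbergZarhin1996, Thm. 6.2 and Cor. 3.3] -/
theorem matrix_eq_one_of_isDomain_of_not_mem_exceptionalSet {n k : ℕ} (hnN : n ∉ exceptionalSet k)
    (hn : ∀ p : ℕ, p.Prime → p ∣ n → ¬ IsUnit (p : O)) {A B : Matrix ι ι O}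
    (hA : IsOfFinOrder A) (hcong : (A - 1) ^ k = (n : O) • B) : A = 1 := by
  have h := matrix_pow_orderBound_eq_one_of_isDomain hn hA hcong
  rwa [orderBound_of_not_mem hnN, pow_one] at h

/-- Theorem 6.2 (b) for integral domains, `k = 1` and `n ≥ 3` (`R(1, n) = 1`): a periodic matrix
over `𝒪` congruent to `1` modulo `n` is the identity — MINKOWSKI's theorem over any integral domain
of characteristic zero in which no prime dividing `n` is invertible (e.g. rings of integers,
orders, `ℤ[1/m]` with `(m, n) = 1`). [cite: SilverbergZarhin1996, Thm. 6.2 (with §1, Minkowski)] -/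
theorem matrix_eq_one_of_isDomain_of_sub_one {n : ℕ} (h3 : 3 ≤ n)
    (hn : ∀ p : ℕ, p.Prime → p ∣ n → ¬ IsUnit (p : O)) {A B : Matrix ι ι O}
    (hA : IsOfFinOrder A) (hcong : A - 1 = (n : O) • B) : A = 1 := by
  have h := matrix_pow_orderBound_eq_one_of_isDomain (k := 1) hn hA (by rw [pow_one, hcong])
  rwa [orderBound_one_of_three_le h3, pow_one] at h

/-- Theorem 6.2 (b) for integral domains, `k = 1` and `n = 2` (`R(1, 2) = 2`): a periodic matrix
over `𝒪` congruent to `1` modulo `2` has `A² = 1` — SERRE's lemma over any integral domain of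
characteristic zero in which `2` is not invertible. [cite: SilverbergZarhin1996, Thm. 6.2 (with §1, Serre)] -/
theorem matrix_sq_eq_one_of_isDomain_of_sub_one (h2 : ¬ IsUnit (2 : O)) {A B : Matrix ι ι O}
    (hA : IsOfFinOrder A) (hcong : A - 1 = (2 : O) • B) : A ^ 2 = 1 := by
  have hn : ∀ p : ℕ, p.Prime → p ∣ 2 → ¬ IsUnit (p : O) := fun p hp hp2 => by
    rw [(Nat.prime_dvd_prime_iff_eq hp Nat.prime_two).1 hp2, Nat.cast_two]
    exact h2
  have h := matrix_pow_orderBound_eq_one_of_isDomain (k := 1) (n := 2) hn hA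
    (by rw [pow_one, hcong, Nat.cast_two])
  rwa [orderBound_one_two] at h

end Matrices

/-! ### §4 Theorems 6.3 (`k = 2`) and 6.4: periodic matrices congruent to `(I *; 0 I)` modulo `n ≥ 4` -/

section BlockUnipotent

variable {O : Type*} [CommRing O]
variable {ι₁ ι₂ : Type*} [Fintype ι₁] [Fintype ι₂] [DecidableEq ι₁] [DecidableEq ι₂]

omit [Fintype ι₁] [Fintype ι₂] in
/-- `(1 b; 0 1) - 1 = (0 b; 0 0)`. [folklore] -/
private theorem fromBlocks_one_sub_one (b : Matrix ι₁ ι₂ O) :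
    Matrix.fromBlocks (1 : Matrix ι₁ ι₁ O) b 0 (1 : Matrix ι₂ ι₂ O) - 1 = Matrix.fromBlocks 0 b 0 0 := by
  rw [sub_eq_iff_eq_add, ← Matrix.fromBlocks_one, Matrix.fromBlocks_add, zero_add, add_zero,
    add_zero, zero_add]

/-- `(0 b; 0 0)² = 0`. [folklore] -/
private theorem fromBlocks_strictUpper_mul_self (b : Matrix ι₁ ι₂ O) :
    (Matrix.fromBlocks (0 : Matrix ι₁ ι₁ O) b 0 (0 : Matrix ι₂ ι₂ O)) *
      Matrix.fromBlocks (0 : Matrix ι₁ ι₁ O) b 0 (0 : Matrix ι₂ ι₂ O) = 0 := by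
  rw [Matrix.fromBlocks_multiply]
  simp

/-- In matrices over a ring without zero-divisors, `c • X = c • Y` with `c ≠ 0` implies `X = Y`.
[folklore] -/
private theorem smul_cancel_of_ne_zero [IsDomain O] {ι : Type*} {c : O} (hc : c ≠ 0)
    {X Y : Matrix ι ι O} (h : c • X = c • Y) : X = Y := by
  ext i j
  have := congr_fun (congr_fun h i) j
  simp only [Matrix.smul_apply, smul_eq_mul] at this
  exact mul_left_cancel₀ hc this

/-- If `A = (1 b; 0 1) + n·C` then `(A - 1)² ∈ n·M(𝒪)` ("the hypotheses imply that
`(A - I)² ∈ nM_g(𝒪)`"). [cite: SilverbergZarhin1996, proof of Thm. 6.4] -/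
theorem sq_sub_one_of_blockUnipotent {n : O} {A : Matrix (ι₁ ⊕ ι₂) (ι₁ ⊕ ι₂) O}
    {b : Matrix ι₁ ι₂ O} {C : Matrix (ι₁ ⊕ ι₂) (ι₁ ⊕ ι₂) O}
    (hAC : A = Matrix.fromBlocks 1 b 0 1 + n • C) :
    (A - 1) ^ 2 = n • (Matrix.fromBlocks (0 : Matrix ι₁ ι₁ O) b 0 (0 : Matrix ι₂ ι₂ O) * C +
      C * Matrix.fromBlocks (0 : Matrix ι₁ ι₁ O) b 0 (0 : Matrix ι₂ ι₂ O) + n • (C * C)) := by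
  have hA1 : A - 1 = Matrix.fromBlocks 0 b 0 0 + n • C := by
    rw [hAC, add_sub_right_comm, fromBlocks_one_sub_one]
  rw [hA1, sq, add_mul, mul_add, mul_add, fromBlocks_strictUpper_mul_self, zero_add,
    Matrix.mul_smul, Matrix.smul_mul, Matrix.smul_mul, Matrix.mul_smul, smul_smul, smul_add,
    smul_add, smul_smul, add_assoc]

variable [IsDomain O] [CharZero O]

/-- **Theorem 6.3 for `k = 2`** ([SilverbergZarhin1996, p. 292], integral domains): `𝒪` an
integral domain of characteristic zero with `2 ∉ 𝒪^×` ("`1 + 2𝒪` has no zero-divisors");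
"Suppose `A ∈ M_g(𝒪)` is a matrix of finite multiplicative order, and suppose that `A` modulo
`2^k M_g(𝒪)` has main diagonal consisting of at most `k` square blocks of identity matrices and is
zero below the diagonal blocks. Then `A = I`" — here `k = 2`: `A ≡ (I *; 0 I) (mod 4)`.
Proof as printed: `A² = I` (Theorem 6.2, `R(2,4) = 2`), so `(I - A)² = 2(I - A) ∈ 4M`, `A = I + 2B`
with `B ≡ (0 *; 0 0) (mod 2)`; `0 = (I + B)(I - A)`, and `det(I + B) ∈ 1 + 2𝒪` is non-zero, so
`I - A = 0`. -- TODO(general form): `k ≥ 3` diagonal blocks modulo `2^k`.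
[cite: SilverbergZarhin1996, Thm. 6.3] -/
theorem matrix_eq_one_of_isDomain_of_blockUnipotent_four (h2 : ¬ IsUnit (2 : O))
    {A : Matrix (ι₁ ⊕ ι₂) (ι₁ ⊕ ι₂) O} (hA : IsOfFinOrder A) {b : Matrix ι₁ ι₂ O}
    {C : Matrix (ι₁ ⊕ ι₂) (ι₁ ⊕ ι₂) O} (hAC : A = Matrix.fromBlocks 1 b 0 1 + (4 : O) • C) :
    A = 1 := by
  set N : Matrix (ι₁ ⊕ ι₂) (ι₁ ⊕ ι₂) O :=
    Matrix.fromBlocks (0 : Matrix ι₁ ι₁ O) b 0 (0 : Matrix ι₂ ι₂ O) with hN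
  have hsq := sq_sub_one_of_blockUnipotent hAC
  set C' := N * C + C * N + (4 : O) • (C * C) with hC'
  have hA1 : A - 1 = N + (4 : O) • C := by
    rw [hAC, add_sub_right_comm, hN, fromBlocks_one_sub_one]
  -- Theorem 6.2 with `k = 2`, `n = 4`: `A² = 1`
  have hn : ∀ p : ℕ, p.Prime → p ∣ 4 → ¬ IsUnit (p : O) := fun p hp hp4 => by
    rw [show (4 : ℕ) = 2 ^ 2 by norm_num] at hp4
    rw [(Nat.prime_dvd_prime_iff_eq hp Nat.prime_two).1 (hp.dvd_of_dvd_pow hp4), Nat.cast_two]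
    exact h2
  have hA2 : A ^ 2 = 1 := by
    have h := matrix_pow_orderBound_eq_one_of_isDomain (k := 2) (n := 4) hn hA
      (B := C') (by rw [hsq]; norm_cast)
    rwa [orderBound_two_four] at h
  -- `(A - 1)² = -2 (A - 1)`, hence `2 (A - 1) = -4 C'` and `A - 1 = -2 C'`
  have hsq' : (A - 1) ^ 2 = -((2 : O) • (A - 1)) := by
    have e : (A - 1) ^ 2 = A ^ 2 + 1 - (2 : O) • A := by
      simp only [sq, sub_mul, mul_sub, one_mul, mul_one, two_smul]
      abel
    rw [e, hA2, smul_sub, two_smul, two_smul]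
    abel
  have hA1' : A - 1 = -((2 : O) • C') := by
    apply smul_cancel_of_ne_zero (two_ne_zero (α := O))
    rw [smul_neg, smul_smul, show (2 : O) * 2 = 4 by norm_num, ← hsq, hsq', neg_neg]
  -- the block `b` is divisible by `2`: `N = (A - 1) - 4C = 2 • D`
  set D : Matrix (ι₁ ⊕ ι₂) (ι₁ ⊕ ι₂) O := -C' - (2 : O) • C with hD
  have hND : N = (2 : O) • D := by
    have e : N = (A - 1) - (4 : O) • C := by rw [hA1, add_sub_cancel_right]
    rw [e, hA1', hD, smul_sub, smul_neg, smul_smul, show (2 : O) * 2 = 4 by norm_num]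
  set b' : Matrix ι₁ ι₂ O := Matrix.of fun i j => D (Sum.inl i) (Sum.inr j) with hb'
  have hb : b = (2 : O) • b' := by
    ext i j
    have := congr_fun (congr_fun hND (Sum.inl i)) (Sum.inr j)
    rw [hN, Matrix.fromBlocks_apply₁₂] at this
    rw [this, hb']
    rfl
  -- `A = 1 + 2B` with `B = (0 b'; 0 0) + 2C`, `B ≡ (0 *; 0 0) (mod 2)`
  set B : Matrix (ι₁ ⊕ ι₂) (ι₁ ⊕ ι₂) O :=
    Matrix.fromBlocks (0 : Matrix ι₁ ι₁ O) b' 0 (0 : Matrix ι₂ ι₂ O) + (2 : O) • C with hB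
  have h2B : (2 : O) • B = A - 1 := by
    rw [hA1, hB, smul_add, Matrix.fromBlocks_smul]
    simp only [smul_zero]
    rw [← hb, smul_smul, show (2 : O) * 2 = 4 by norm_num]
  have hAB : A = 1 + (2 : O) • B := by rw [h2B, add_sub_cancel]
  -- `A² = 1` gives `(1 + B) B = 0`
  have hBB : (1 + B) * B = 0 := by
    have e : A ^ 2 = 1 + (4 : O) • ((1 + B) * B) := by
      rw [hAB, sq]
      simp only [add_mul, mul_add, one_mul, mul_one, Matrix.smul_mul, Matrix.mul_smul, smul_smul,
        smul_add]
      module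
    rw [hA2] at e
    have e' : (4 : O) • ((1 + B) * B) = (4 : O) • 0 := by
      rw [smul_zero]
      exact (add_eq_left.1 e.symm)
    exact smul_cancel_of_ne_zero (by norm_num) e'
  -- `det (1 + B) ∈ 1 + 2𝒪` is non-zero
  have hdet : (1 + B).det ≠ 0 := by
    set π := Ideal.Quotient.mk (Ideal.span {(2 : O)}) with hπ
    have hπ2 : π 2 = 0 := (Ideal.Quotient.eq_zero_iff_mem).2 (Ideal.mem_span_singleton_self 2)
    have hU : 1 + B = Matrix.fromBlocks 1 b' 0 1 + (2 : O) • C := by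
      rw [hB, ← add_assoc, ← Matrix.fromBlocks_one, Matrix.fromBlocks_add, add_zero, add_zero,
        add_zero, zero_add]
    have hmap : π.mapMatrix (1 + B) = π.mapMatrix (Matrix.fromBlocks 1 b' 0 1) := by
      rw [hU, map_add, add_eq_left, RingHom.mapMatrix_apply, Matrix.map_smul' _ _ _ (map_mul π),
        hπ2, zero_smul]
    have hdet1 : π (1 + B).det = 1 := by
      rw [RingHom.map_det, hmap, ← RingHom.map_det, Matrix.det_fromBlocks_zero₂₁, Matrix.det_one,
        Matrix.det_one, mul_one, map_one]
    intro h0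
    rw [h0, map_zero] at hdet1
    have : (1 : O) ∈ Ideal.span {(2 : O)} := by
      rw [← Ideal.Quotient.eq_zero_iff_mem, map_one]
      exact hdet1.symm
    exact h2 (isUnit_of_dvd_one (Ideal.mem_span_singleton.1 this))
  -- hence `B = 0` and `A = 1`
  have hB0 : B = 0 := by
    have e : (1 + B).det • B = 0 := by
      calc (1 + B).det • B = ((1 + B).det • (1 : Matrix (ι₁ ⊕ ι₂) (ι₁ ⊕ ι₂) O)) * B := by
            rw [Matrix.smul_mul, Matrix.one_mul]
        _ = (1 + B).adjugate * (1 + B) * B := by rw [Matrix.adjugate_mul]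
        _ = 0 := by rw [Matrix.mul_assoc, hBB, Matrix.mul_zero]
    ext i j
    have := congr_fun (congr_fun e i) j
    simp only [Matrix.smul_apply, smul_eq_mul, Matrix.zero_apply, mul_eq_zero] at this
    exact this.resolve_left hdet
  rw [hAB, hB0, smul_zero, add_zero]

/-- **Theorem 6.4** ([SilverbergZarhin1996, p. 292], integral domains): `𝒪` an integral domain of
characteristic zero in which no prime dividing `n` is a unit, `n ≥ 4`; "if `A ∈ M_g(𝒪)` is a
matrix of finite multiplicative order, `0 ≤ a ≤ g`, and `b` is an `a × (g - a)` matrix over `𝒪`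
such that `A ∈ (I_a b; 0 I_{g-a}) + nM_g(𝒪)`, then `A = I`." (Proof as printed:
`(A - I)² ∈ nM_g(𝒪)`, so Theorem 6.2 with `k = 2` gives `A = I` for `n ≥ 5`; `n = 4` is
Theorem 6.3.) The bound is sharp: `sharp_blockUnipotent_three`, `sharp_blockUnipotent_two`.
[cite: SilverbergZarhin1996, Thm. 6.4] -/
theorem matrix_eq_one_of_isDomain_of_blockUnipotent {n : ℕ} (h4 : 4 ≤ n)
    (hn : ∀ p : ℕ, p.Prime → p ∣ n → ¬ IsUnit (p : O))
    {A : Matrix (ι₁ ⊕ ι₂) (ι₁ ⊕ ι₂) O} (hA : IsOfFinOrder A) {b : Matrix ι₁ ι₂ O}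
    {C : Matrix (ι₁ ⊕ ι₂) (ι₁ ⊕ ι₂) O} (hAC : A = Matrix.fromBlocks 1 b 0 1 + (n : O) • C) :
    A = 1 := by
  rcases (show n = 4 ∨ 5 ≤ n by omega) with rfl | h5
  · exact matrix_eq_one_of_isDomain_of_blockUnipotent_four (by exact_mod_cast hn 2 Nat.prime_two ⟨2, rfl⟩)
      hA (by rw [hAC]; norm_cast)
  · have h := matrix_pow_orderBound_eq_one_of_isDomain (k := 2) hn hA
      (sq_sub_one_of_blockUnipotent hAC)
    rwa [orderBound_two_of_five_le h5, pow_one] at h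

end BlockUnipotent

/-! ### §5 Sharpness of Theorem 6.4: `n = 3` and `n = 2` -/

section Sharp

/-- `n = 3` is not enough in Theorem 6.4: `A = (1 1; -3 -2) ≡ (1 1; 0 1) (mod 3)` has order `3`
(our example, cf. the paper's Example 6.5; consistent with `R(2, 3) = 3`).
[cite: SilverbergZarhin1996, Thm. 6.4 and Example 6.5] -/
theorem sharp_blockUnipotent_three :
    (Matrix.fromBlocks 1 1 ((-3 : ℤ) • 1) ((-2 : ℤ) • 1) : Matrix (Fin 1 ⊕ Fin 1) (Fin 1 ⊕ Fin 1) ℤ)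
        = Matrix.fromBlocks 1 1 0 1 + (3 : ℤ) • Matrix.fromBlocks 0 0 ((-1 : ℤ) • 1) ((-1 : ℤ) • 1) ∧
      (Matrix.fromBlocks 1 1 ((-3 : ℤ) • 1) ((-2 : ℤ) • 1) :
          Matrix (Fin 1 ⊕ Fin 1) (Fin 1 ⊕ Fin 1) ℤ) ^ 3 = 1 ∧
      (Matrix.fromBlocks 1 1 ((-3 : ℤ) • 1) ((-2 : ℤ) • 1) :
          Matrix (Fin 1 ⊕ Fin 1) (Fin 1 ⊕ Fin 1) ℤ) ≠ 1 := by
  refine ⟨by decide, by decide, by decide⟩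

/-- `n = 2`: `A = (1 1; -2 -1) ≡ (1 1; 0 1) (mod 2)` has order `4` (our example, cf. the paper's
Example 6.5; consistent with `R(2, 2) = 4`). [cite: SilverbergZarhin1996, Thm. 6.4 and Example 6.5] -/
theorem sharp_blockUnipotent_two :
    (Matrix.fromBlocks 1 1 ((-2 : ℤ) • 1) ((-1 : ℤ) • 1) : Matrix (Fin 1 ⊕ Fin 1) (Fin 1 ⊕ Fin 1) ℤ)
        = Matrix.fromBlocks 1 1 0 1 + (2 : ℤ) • Matrix.fromBlocks 0 0 ((-1 : ℤ) • 1) ((-1 : ℤ) • 1) ∧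
      (Matrix.fromBlocks 1 1 ((-2 : ℤ) • 1) ((-1 : ℤ) • 1) :
          Matrix (Fin 1 ⊕ Fin 1) (Fin 1 ⊕ Fin 1) ℤ) ^ 4 = 1 ∧
      (Matrix.fromBlocks 1 1 ((-2 : ℤ) • 1) ((-1 : ℤ) • 1) :
          Matrix (Fin 1 ⊕ Fin 1) (Fin 1 ⊕ Fin 1) ℤ) ^ 2 ≠ 1 := by
  refine ⟨by decide, by decide, by decide⟩

end Sharp

end SilverbergZarhin

end Literature.GroupTheory.ArithmeticGroups
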